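import Summits.ResolutionOfSingularities.ResolutionOfSingularities.Theorems.PurelyInseparableDim4ScopeTreeCert
import HarnessLib

/-!
# R_OD-GLOBAL IS DEAD AT `(p,q) = (2,2)` AS A UNIFORM RULE ‖ K: the located in-scope HOP 2-CYCLE S1a-296 —
# a 2-state region closed for player B in the GLOBAL game `Edge` against every permissible coordinate
# COMPONENT, both states IN COORDINATE SCOPE (cell `res-dim4-pi`, seat res-dim4-p-4 g2, WORD #82 (a) / #74 (c))

[OURS · counted 0 · a kernel certificate of a LOCATED SPECIMEN of this cell: res-dim4-eng-w4 g2's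
R_OD-global census j319049 (S-1a band, stride-8 sample, `(p,q) = (2,2)`), root S1a-296, reading fixed 22:06Z;
K = B by res-dim4-crit-3 g2 (`cyc22.py`, own 𝔽₂ step map with hops, scope by hand on `∂F`) and
res-dim4-crit-4 g2 (third step map); re-derived here by a fourth independent stdlib replay and certified in the
kernel in res-dim4-p-8 g2's `LoopCRegion` / `HopRegions` format at `q = 2` (`LoopC.regionB`, and the
branching in-scope checker `LoopC.scopeTreeB` of `…ScopeTreeCert`, needed because the flat
`LoopC.scopeCertB` does not reach these two states).  A statement about OUR coordinate-centre frame
(`PIDim4.Edge`, `PIDim4.StepRule`, `PIDim4.InCoordinateScope`, `ComponentThreads.IsComponent`) ONLY: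
«R_OD-glob is DEAD at (2,2) as a UNIFORM rule (a shade-flat along-centre hop 2-cycle between lone-LINE
states)» — NOTHING about the ∃-form F4-C-glob(2,2) (`TerminatesInScope 2 2`: the `BandWin` files certify SOME
winning A per root), nothing about the local game `EdgeLoc`, and nothing here proves or refutes
resolution of singularities in dimension `≥ 4` / characteristic `p`.]

THE SPECIMEN (over `𝔽₂`, `q = 2`, variables `x₁ … x₄`; bookkeeping `r = 0`, `exc = {x₄}`, stationary):
* `A = x₂x₄ + x₂x₃² + x₃x₄³ + x₁²x₂x₄ + x₁x₃x₄³ + x₁²x₃x₄³ + x₁³x₃x₄³`: permissible coordinate centres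
  `V(x₂,x₃,x₄)` and the point; its ONLY component (`ComponentThreads.IsComponent 2`) is the LINE
  `V(x₂,x₃,x₄)` (the `x₁`-axis `= Sing₂(A)` through `0`); B answers its blow-up in the `x₄`-chart at
  `b = (1,0,1,0)` — the HOP `x₁ ↦ x₁ + 1` ALONG the centre with fibre coordinate `x₃ = 1` — and lands on
* `B = x₂x₄ + x₁²x₂ + x₂x₃²x₄ + x₁³x₄² + x₁³x₃x₄²`: only component the LINE `V(x₁,x₂,x₄)` (the `x₃`-axis);
  B answers in the `x₄`-chart at `b = (1,0,1,0)` — the HOP `x₃ ↦ x₃ + 1` along the centre, fibre `x₁ = 1` —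
  and lands on `A` LITERALLY (no squares deleted either way; shade `d = 2` at both: a flat cycle).
So every coordinate rule that blows up a COMPONENT of the `2`-fold locus whenever one exists — in
particular every «maximal-dimensional component» rule with any tie-breaks (old-first / deepest / lex:
the cell's R_OD-global; there is nothing to break here) — has the infinite in-scope branch `A B A B …` in
the GLOBAL game over `𝔽₂`.

WHAT IS CERTIFIED (`decide` on res-dim4-p-13's presented states; soundness lemmas are p-8 g2's
`LoopC.region_of_regionB` and this seat's `LoopC.inCoordinateScope_of_scopeTreeB`): §1 data; §2 the kernel
checks `regionB_rod22`, `scope_sA`, `scope_sB`, the literal steps and the uniqueness of the component at each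
state (`LoopC.uniqueCompB`, §0, generic with its branch lemma); §3 conclusions `rod22_region`, `rod22_inScope`,
`rod22_lone`, `isComponent_sA_iff` / `_sB_iff`, `step_sA` / `step_sB`, `edge_sA_sB` / `edge_sB_sA`, `equalD_sA_sB`,
and the rule-level negatives `ROD22.exists_inScope_branch_of_loneComponentRule` /
`ROD22.not_terminatesUnder_of_loneComponentRule` (the LONE-COMPONENT class of p-8 g2's `…LoopERegion`, here at
`(2,2)` over `𝔽₂`) with the component-rule and max-dimensional-rule corollaries.
bears_on: LADDER-RESOLUTION:D157-DOOR2 (res-dim4-pi · F4-C-glob(2,2) · R_OD-glob (2,2) hop 2-cycle S1a-296 ‖ K).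
Supports stmt-ResolutionOfSingularities-16155 (helper).
-/

set_option linter.dupNamespace false -- mandated namespace of this single-conjunct summit

noncomputable section

open MvPolynomial Finset
open scoped BigOperators

namespace Summit.ResolutionOfSingularities.ResolutionOfSingularities.Theorems.PIDim4

namespace LoopC

open StepKit ScopeCover ComponentThreads
open Literature.AlgebraicGeometry.Resolution
open Literature.AlgebraicGeometry.Resolution.CentreBlowup

/-! ## §0 Uniqueness of the component as a Boolean check (generic) -/

section Generic

variable {K : Type} [Field K] [DecidableEq K]

/-- Every listed state has AT MOST ONE component (`ComponentThreads.IsComponent`). [folklore] -/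
def uniqueCompB (q : ℕ) (TW : TrapRows K) : Bool :=
  TW.all fun sw => decide (∀ S S' : Finset (Fin 4), componentB q S sw.1.L = true → componentB q S' sw.1.L = true → S = S')

/-- Transfer of `uniqueCompB`. [folklore] -/
theorem component_unique_of_uniqueCompB {q : ℕ} {TW : TrapRows K} (h : uniqueCompB q TW = true) :
    ∀ s ∈ trapSet TW, ∀ S S', IsComponent q S s.F → IsComponent q S' s.F → S = S' := by
  rintro x ⟨sw, hsw, rfl⟩ S S' hS hS'
  simp only [uniqueCompB, List.all_eq_true, decide_eq_true_eq] at h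
  rw [SData.toState_F, isComponent_iff] at hS hS'
  exact h sw hsw S S' hS hS'

/-- On a region table passing `regionB` whose states have unique components, every LONE-COMPONENT rule
(a rule that blows up THE component whenever the `q`-fold coordinate locus has exactly one — the weakest
component-keyed hypothesis: R_OD, cardinality-first, max-dimensional-first, any tie-break) has, from every
region state, a `StepRule`-successor inside the region. [folklore] -/
theorem exists_stepRule_of_regionB_of_uniqueCompB {q : ℕ} {TW : TrapRows K} (hreg : regionB q TW = true)
    (huniq : uniqueCompB q TW = true) (R : CentreRule K)
    (hR : ∀ (s : State K) (S : Finset (Fin 4)), IsComponent q S s.F →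
      (∀ S', IsComponent q S' s.F → S' = S) → R s = S) :
    ∀ s ∈ trapSet TW, ∃ s' ∈ trapSet TW, StepRule q R s s' := by
  intro s hs
  obtain ⟨-, ⟨S₀, hS₀, hmin⟩, hall⟩ := region_of_regionB hreg s hs
  have hRS : R s = S₀ :=
    hR s S₀ hS₀ fun S' hS' => (component_unique_of_uniqueCompB huniq s hs S₀ S' hS₀ hS').symm
  obtain ⟨s', hs', hedge⟩ := hall S₀ hS₀ hmin
  exact ⟨s', hs', hRS ▸ hS₀.1, hRS ▸ hedge⟩

/-- An infinite branch inside the region from any member, for every lone-component rule (choice along the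
successor relation). [folklore] -/
theorem exists_branch_of_regionB_of_uniqueCompB {q : ℕ} {TW : TrapRows K} (hreg : regionB q TW = true)
    (huniq : uniqueCompB q TW = true) (R : CentreRule K)
    (hR : ∀ (s : State K) (S : Finset (Fin 4)), IsComponent q S s.F →
      (∀ S', IsComponent q S' s.F → S' = S) → R s = S)
    {s₀ : State K} (h₀ : s₀ ∈ trapSet TW) :
    ∃ c : ℕ → State K, c 0 = s₀ ∧ (∀ k, c k ∈ trapSet TW) ∧ ∀ k, StepRule q R (c k) (c (k + 1)) := by
  have key : ∀ s : trapSet TW, ∃ s' : trapSet TW, StepRule q R (s : State K) (s' : State K) := by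
    rintro ⟨s, hs⟩
    obtain ⟨s', hs', hstep⟩ := exists_stepRule_of_regionB_of_uniqueCompB hreg huniq R hR s hs
    exact ⟨⟨s', hs'⟩, hstep⟩
  choose f hf using key
  refine ⟨fun k => ((f^[k] ⟨s₀, h₀⟩ : trapSet TW) : State K), rfl, fun k => (f^[k] ⟨s₀, h₀⟩).2, fun k => ?_⟩
  show StepRule q R ((f^[k] _ : trapSet TW) : State K) ((f^[k + 1] _ : trapSet TW) : State K)
  rw [Function.iterate_succ_apply']
  exact hf _

end Generic

end LoopC

namespace ROD22

open StepKit ScopeCover ComponentThreads LoopC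
open Literature.AlgebraicGeometry.Resolution
open Literature.AlgebraicGeometry.Resolution.CentreBlowup

/-! ## §1 The S1a-296 data (over `𝔽₂`) -/

/-- State `A = x₂x₄ + x₂x₃² + x₃x₄³ + x₁²x₂x₄ + x₁x₃x₄³ + x₁²x₃x₄³ + x₁³x₃x₄³` (eng-w4 g2's S1a-296 cycle entry),
bookkeeping `r = 0`, `exc = {x₄}`. [OURS · specimen] -/
def sA : SData 4 (ZMod 2) :=
  ⟨[(![0, 1, 0, 1], 1), (![0, 1, 2, 0], 1), (![0, 0, 1, 3], 1), (![2, 1, 0, 1], 1), (![1, 0, 1, 3], 1),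
    (![2, 0, 1, 3], 1), (![3, 0, 1, 3], 1)], ![0, 0, 0, 0], {3}⟩

/-- State `B = x₂x₄ + x₁²x₂ + x₂x₃²x₄ + x₁³x₄² + x₁³x₃x₄²`, bookkeeping `r = 0`, `exc = {x₄}`. [OURS · specimen] -/
def sB : SData 4 (ZMod 2) :=
  ⟨[(![0, 1, 0, 1], 1), (![2, 1, 0, 0], 1), (![0, 1, 2, 1], 1), (![3, 0, 0, 2], 1), (![3, 0, 1, 2], 1)],
    ![0, 0, 0, 0], {3}⟩

/-- **The 2-cycle table**: at `A` the reply to the (unique) component `V(x₂,x₃,x₄)` is the `x₄`-chart point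
`b = (1,0,1,0)` onto `B` (row 1); at `B` the reply to `V(x₁,x₂,x₄)` is the `x₄`-chart point `b = (1,0,1,0)`
onto `A` (row 0). [OURS · specimen · eng-w4 g2 S1a-296] -/
def rod22 : TrapRows (ZMod 2) :=
  [(sA, [({1, 2, 3}, 3, ![1, 0, 1, 0], 1)]),
   (sB, [({0, 1, 3}, 3, ![1, 0, 1, 0], 0)])]

/-! ## §2 Kernel checks -/

/-- The table checks: `2`-fold origins, a maximal-dimensional component at each state, every one answered
inside the table. [OURS · ‖ K] -/
theorem regionB_rod22 : regionB 2 rod22 = true := by decide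

/-- Each state has exactly one component. [OURS · ‖ K] -/
theorem uniqueCompB_rod22 : uniqueCompB 2 rod22 = true := by decide

/-- `A` is in coordinate scope, by the branching checker (forced `x₄`, then `x₃` modulo `x₄`, then `x₂`;
or via the mixed witness `∂₁A = x₃x₄³(1+x₁²)`). [OURS · ‖ K] -/
theorem scope_sA : scopeTreeB 2 sA.L 4 ∅ = true := by decide

/-- `B` is in coordinate scope, by the branching checker (`∂₄B = x₂(1+x₃²)` forces `x₂`; the mixed witness
`∂₁B = x₁²x₄²(1+x₃)` splits into `x₁ ∈ P` / `x₄ ∈ P`, each closed by `∂₂B = x₄(1+x₃²) + x₁²`). [OURS · ‖ K] -/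
theorem scope_sB : scopeTreeB 2 sB.L 4 ∅ = true := by decide

/-- The components of `A` are exactly `{V(x₂,x₃,x₄)}` (Boolean form). [OURS · ‖ K] -/
theorem componentB_sA (S : Finset (Fin 4)) : componentB 2 S sA.L = decide (S = {1, 2, 3}) := by
  revert S; decide

/-- The components of `B` are exactly `{V(x₁,x₂,x₄)}` (Boolean form). [OURS · ‖ K] -/
theorem componentB_sB (S : Finset (Fin 4)) : componentB 2 S sB.L = decide (S = {0, 1, 3}) := by
  revert S; decide

/-! ## §3 Conclusions -/

/-- **The components of `A`**: `V(x_S)` is a component of the `2`-fold locus of `A` iff `S = {x₂,x₃,x₄}` — a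
lone LINE, so every component rule (R_OD-global included) must blow it up. [OURS · ‖ K] -/
theorem isComponent_sA_iff (S : Finset (Fin 4)) : IsComponent 2 S sA.toState.F ↔ S = {1, 2, 3} := by
  rw [SData.toState_F, isComponent_iff, componentB_sA, decide_eq_true_eq]

/-- **The components of `B`**: `V(x_S)` is a component iff `S = {x₁,x₂,x₄}`. [OURS · ‖ K] -/
theorem isComponent_sB_iff (S : Finset (Fin 4)) : IsComponent 2 S sB.toState.F ↔ S = {0, 1, 3} := by
  rw [SData.toState_F, isComponent_iff, componentB_sB, decide_eq_true_eq]

/-- **The hop `A → B` literally**: blowing up `V(z, x₂,x₃,x₄)` and passing to the `x₄`-chart point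
`b = (1,0,1,0)` (hop `x₁ ↦ x₁ + 1` along the centre, fibre `x₃ = 1`) gives EXACTLY `B`. [OURS · ‖ K] -/
theorem step_sA : CentreBlowup.step 2 {1, 2, 3} 3 ![1, 0, 1, 0] sA.toState = sB.toState :=
  (step_eq_iff 2 {1, 2, 3} 3 ![1, 0, 1, 0] sA sB).mpr (by decide)

/-- **The hop `B → A` literally**: blowing up `V(z, x₁,x₂,x₄)` and passing to the `x₄`-chart point
`b = (1,0,1,0)` (hop `x₃ ↦ x₃ + 1` along the centre, fibre `x₁ = 1`) gives EXACTLY `A`. [OURS · ‖ K] -/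
theorem step_sB : CentreBlowup.step 2 {0, 1, 3} 3 ![1, 0, 1, 0] sB.toState = sA.toState :=
  (step_eq_iff 2 {0, 1, 3} 3 ![1, 0, 1, 0] sB sA).mpr (by decide)

/-- The edge `A → B` in the cell's global game (equimultiple point, non-zero cleaned transform). [OURS · ‖ K] -/
theorem edge_sA_sB : Edge 2 {1, 2, 3} sA.toState sB.toState :=
  edge_of 3 ![1, 0, 1, 0] (by decide) (by decide) (by decide) (by decide) (by decide)

/-- The edge `B → A` in the cell's global game. [OURS · ‖ K] -/
theorem edge_sB_sA : Edge 2 {0, 1, 3} sB.toState sA.toState :=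
  edge_of 3 ![1, 0, 1, 0] (by decide) (by decide) (by decide) (by decide) (by decide)

/-- **Flatness**: the shade does not move around the cycle (`d = 2` at `A` and at `B`). [OURS · ‖ K] -/
theorem equalD_sA_sB : EqualD sA.toState sB.toState ∧ EqualD sB.toState sA.toState :=
  ⟨(equalD_iff _ _).mpr (by decide), (equalD_iff _ _).mpr (by decide)⟩

/-- **The region form (GLOBAL game `Edge`)**: every state of `{A, B}` has a `2`-fold origin, a
maximal-dimensional component, and for every such component an `Edge`-successor inside `{A, B}`. [OURS · ‖ K] -/
theorem rod22_region : ∀ s ∈ trapSet rod22, (2 : ℕ∞) ≤ ordAlong Finset.univ s.F ∧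
    (∃ S, IsComponent 2 S s.F ∧ ∀ S', IsComponent 2 S' s.F → S.card ≤ S'.card) ∧
    ∀ S, IsComponent 2 S s.F → (∀ S', IsComponent 2 S' s.F → S.card ≤ S'.card) →
      ∃ s' ∈ trapSet rod22, Edge 2 S s s' :=
  region_of_regionB regionB_rod22

/-- **Scope form**: both states are IN COORDINATE SCOPE (their `2`-fold loci through the origin are the
coordinate lines `V(x₂,x₃,x₄)` resp. `V(x₁,x₂,x₄)`). [OURS · ‖ K] -/
theorem rod22_inScope : ∀ s ∈ trapSet rod22, InCoordinateScope 2 s.F := by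
  rintro s ⟨sw, hsw, rfl⟩
  simp only [rod22, List.mem_cons, List.not_mem_nil, or_false] at hsw
  rcases hsw with rfl | rfl
  · exact inCoordinateScope_toState_of_scopeTreeB scope_sA
  · exact inCoordinateScope_toState_of_scopeTreeB scope_sB

/-- `A` presents a member of the region (non-emptiness). [OURS] -/
theorem sA_mem_rod22 : sA.toState ∈ trapSet rod22 :=
  ⟨(sA, [({1, 2, 3}, 3, ![1, 0, 1, 0], 1)]), by simp [rod22], rfl⟩

/-- **Lone components**: at each state of the region the coordinate `2`-fold locus has EXACTLY ONE component.
[OURS · ‖ K] -/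
theorem rod22_lone : ∀ s ∈ trapSet rod22, ∀ S S', IsComponent 2 S s.F → IsComponent 2 S' s.F → S' = S :=
  fun s hs S S' hS hS' => (component_unique_of_uniqueCompB uniqueCompB_rod22 s hs S S' hS hS').symm

/-- **R_OD-GLOBAL DEAD AT (2,2) AS A UNIFORM RULE, rule form**: over `𝔽₂`, every coordinate rule that blows
up THE component whenever the coordinate `2`-fold locus has exactly one (R_OD-global with any tie-break,
cardinality-first, max-dimensional-first, … — every rule keyed to the component structure) has the infinite
branch `A B A B …` inside `{A, B}`, all states in coordinate scope, in the GLOBAL game `StepRule`. Nothing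
about the ∃-form `TerminatesInScope 2 2`. [OURS · ‖ K] -/
theorem exists_inScope_branch_of_loneComponentRule (R : CentreRule (ZMod 2))
    (hR : ∀ (s : State (ZMod 2)) (S : Finset (Fin 4)), IsComponent 2 S s.F →
      (∀ S', IsComponent 2 S' s.F → S' = S) → R s = S) :
    ∃ c : ℕ → State (ZMod 2), c 0 = sA.toState ∧ (∀ k, c k ∈ trapSet rod22) ∧
      ∀ k, InCoordinateScope 2 (c k).F ∧ StepRule 2 R (c k) (c (k + 1)) := by
  obtain ⟨c, h0, hmem, hstep⟩ :=
    exists_branch_of_regionB_of_uniqueCompB regionB_rod22 uniqueCompB_rod22 R hR sA_mem_rod22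
  exact ⟨c, h0, hmem, fun k => ⟨rod22_inScope _ (hmem k), hstep k⟩⟩

/-- Hence no lone-component rule terminates over `𝔽₂` at `q = 2` (`PIDim4.TerminatesUnder 2`), although every
state it visits from `A` stays in coordinate scope. [OURS · ‖ K] -/
theorem not_terminatesUnder_of_loneComponentRule (R : CentreRule (ZMod 2))
    (hR : ∀ (s : State (ZMod 2)) (S : Finset (Fin 4)), IsComponent 2 S s.F →
      (∀ S', IsComponent 2 S' s.F → S' = S) → R s = S) :
    ¬ TerminatesUnder 2 R := by
  intro hterm
  obtain ⟨c, -, -, hc⟩ := exists_inScope_branch_of_loneComponentRule R hR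
  exact hterm ⟨c, fun k => (hc k).2⟩

/-- **Corollary — COMPONENT rules** (blow up SOME component whenever one exists; the hypothesis of p-8 g2's
`LoopC.not_terminatesUnder_of_componentRule` at `(3,3)`): an infinite in-scope branch inside `{A, B}` over `𝔽₂`
at `q = 2`. [OURS · ‖ K] -/
theorem exists_inScope_branch_of_componentRule (R : CentreRule (ZMod 2))
    (hR : ∀ s : State (ZMod 2), (∃ S, IsComponent 2 S s.F) → IsComponent 2 (R s) s.F) :
    ∃ c : ℕ → State (ZMod 2), c 0 = sA.toState ∧ (∀ k, c k ∈ trapSet rod22) ∧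
      ∀ k, InCoordinateScope 2 (c k).F ∧ StepRule 2 R (c k) (c (k + 1)) :=
  exists_inScope_branch_of_loneComponentRule R fun s S hS huniq => huniq (R s) (hR s ⟨S, hS⟩)

/-- **Corollary — MAXIMAL-DIMENSIONAL-component rules** (the hypothesis of p-8 g2's
`LoopC.exists_inScope_branch_of_maxDimRule` at `(3,3)`; R_OD-global is one of them): an infinite in-scope
branch inside `{A, B}` over `𝔽₂` at `q = 2`. [OURS · ‖ K] -/
theorem exists_inScope_branch_of_maxDimRule (R : CentreRule (ZMod 2))
    (hR : ∀ s : State (ZMod 2),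
      (∃ S, IsComponent 2 S s.F ∧ ∀ S', IsComponent 2 S' s.F → S.card ≤ S'.card) →
        IsComponent 2 (R s) s.F ∧ ∀ S', IsComponent 2 S' s.F → (R s).card ≤ S'.card) :
    ∃ c : ℕ → State (ZMod 2), c 0 = sA.toState ∧ (∀ k, c k ∈ trapSet rod22) ∧
      ∀ k, InCoordinateScope 2 (c k).F ∧ StepRule 2 R (c k) (c (k + 1)) :=
  exists_inScope_branch_of_loneComponentRule R fun s S hS huniq => by
    have hmax : IsComponent 2 S s.F ∧ ∀ S', IsComponent 2 S' s.F → S.card ≤ S'.card :=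
      ⟨hS, fun S' hS' => (huniq S' hS').symm ▸ le_rfl⟩
    exact huniq (R s) (hR s ⟨S, hmax⟩).1

/-- … so neither a component rule nor a maximal-dimensional-component rule terminates over `𝔽₂` at `q = 2`.
[OURS · ‖ K] -/
theorem not_terminatesUnder_of_maxDimRule (R : CentreRule (ZMod 2))
    (hR : ∀ s : State (ZMod 2),
      (∃ S, IsComponent 2 S s.F ∧ ∀ S', IsComponent 2 S' s.F → S.card ≤ S'.card) →
        IsComponent 2 (R s) s.F ∧ ∀ S', IsComponent 2 S' s.F → (R s).card ≤ S'.card) :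
    ¬ TerminatesUnder 2 R := by
  intro hterm
  obtain ⟨c, -, -, hc⟩ := exists_inScope_branch_of_maxDimRule R hR
  exact hterm ⟨c, fun k => (hc k).2⟩

end ROD22

end Summit.ResolutionOfSingularities.ResolutionOfSingularities.Theorems.PIDim4

end
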